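import Summits.BirchSwinnertonDyer.Rank2.CertifiedPartnerTypeANeighbourIsogeny
import Summits.BirchSwinnertonDyer.Rank2.CertifiedPartnerTypeB
import Summits.BirchSwinnertonDyer.Rank1Residual.X5.TwoAdicInstancesToolkit
import HarnessLib

/-!
# Certified partners of Greenberg type A, III: `2`-torsion bookkeeping of `W′_i` and `W″_i` (cell `bsd-rank2`)

Cell `bsd-rank2` (D-0036), seat `bsd-rank2-lit` GEN 18, stub `stub_partnerCF` (E1M line `cfsplit`, crux
`DepletedLambdaLawAtTwoMod`), TYPE A, both branches (`D = 4i+1`, `D = 4i+3`, `i ≥ 0`):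

* the partner `W′_i` has the rational point of order `2` with abscissa `x′ = −(16i+25)/4`, RAMIFIED at `2`
  (`v₂ = −2`) and NOT ODD (the `2`-division cubic is `(4X + 16i + 25)((X + 7i + 19)² − 36D)`, resp.
  `(4X + 16i + 25)((X + 13i + 17)² − 36D)`, with the real root `−7i − 19 − 6√D < x′`, resp. `−13i − 17 − 6√D < x′`):
  TYPE A; it is the UNIQUE rational `2`-torsion abscissa when `D` is not a square;
* the neighbour `W″_i` has the three rational `2`-torsion abscissae `0, 12, (12i+3)/4`, resp. `0, 4, (36i+27)/4`, and
  the Prop-5.14 point at `(12i+3)/4`, resp. `(36i+27)/4` (ramified, not odd since `0` is a smaller root).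

PARTITION: none — r_an ≥ 2, summit axis S0; TWIN (D-0056): n/a. B1: explicit-model algebra; no `L`-function, no Selmer
group, no S0 motion. No named fact, no `sorry`.
-/

noncomputable section

namespace Summit.BirchSwinnertonDyer.Rank2

open _root_.WeierstrassCurve
open Literature.NumberTheory.EllipticCurves
open Literature.NumberTheory.EllipticCurves.Greenberg1999

section PartnerTypeATorsion

/-! ### Ramification at `2` of abscissae `odd/4`

`v₂(n/4) = −2 < 0` for `n` odd is the tree lemma
`Summit.BirchSwinnertonDyer.Rank1Residual.X5.Instances.twoTorsionRamifiedAtTwo_of_odd_div_four`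
(cell `bsd-2adic`'s toolkit), reused here rather than restated. -/

/-! ### The partner `W′_i`, branch `D = 4i + 1` -/

/-- `x′ = −(16i+25)/4` is a rational `2`-torsion abscissa of `W′_i`. [folklore] -/
theorem hasRationalTwoTorsionX_partnerAOne (i : ℤ) :
    HasRationalTwoTorsionX
      (⟨1, ((18 * i + 44 : ℤ) : ℚ), ((3 * i + 7 : ℤ) : ℚ), ((105 * i ^ 2 + 360 * i + 559 : ℤ) : ℚ),
        ((196 * i ^ 3 + 792 * i ^ 2 + 2052 * i + 2019 : ℤ) : ℚ)⟩ : WeierstrassCurve ℚ)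
      (((-(16 * i + 25) : ℤ) : ℚ) / 4) := by
  refine hasRationalTwoTorsionX_of_twoDivision_root ?_
  simp only [WeierstrassCurve.b₂, WeierstrassCurve.b₄, WeierstrassCurve.b₆]
  push_cast
  ring

/-- `x′` is the UNIQUE rational `2`-torsion abscissa of `W′_i` when `4i+1` is not a square: another abscissa `z`
satisfies `(z + 7i + 19)² = 36(4i+1)`. [folklore] -/
theorem hasUniqueRationalTwoTorsionX_partnerAOne (i : ℤ) (hns : ¬ IsSquare ((4 * i + 1 : ℤ) : ℚ)) :
    HasUniqueRationalTwoTorsionX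
      (⟨1, ((18 * i + 44 : ℤ) : ℚ), ((3 * i + 7 : ℤ) : ℚ), ((105 * i ^ 2 + 360 * i + 559 : ℤ) : ℚ),
        ((196 * i ^ 3 + 792 * i ^ 2 + 2052 * i + 2019 : ℤ) : ℚ)⟩ : WeierstrassCurve ℚ)
      (((-(16 * i + 25) : ℤ) : ℚ) / 4) := by
  refine ⟨hasRationalTwoTorsionX_partnerAOne i, fun z hz ↦ ?_⟩
  obtain ⟨y, hy, h2⟩ := hz
  have hc := fourXCubed_add_eq_zero_of_twoTorsion hy h2
  simp only [WeierstrassCurve.b₂, WeierstrassCurve.b₄, WeierstrassCurve.b₆] at hc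
  push_cast at hc ⊢
  have hq : (4 * z + 16 * i + 25) * ((z + 7 * i + 19) ^ 2 - 36 * (4 * i + 1)) = 0 := by
    linear_combination hc
  rcases mul_eq_zero.mp hq with h | h
  · linarith
  · exact absurd ⟨(z + 7 * i + 19) / 6, by push_cast; linear_combination (-(1 : ℚ) / 36) * h⟩ hns

/-- `x′ = −(16i+25)/4` is RAMIFIED at `2`. [cite: GreenbergLNM1716, §5 (chunk p0168)] -/
theorem twoTorsionRamifiedAtTwo_partnerA (i : ℤ) : TwoTorsionRamifiedAtTwo (((-(16 * i + 25) : ℤ) : ℚ) / 4) :=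
  Rank1Residual.X5.Instances.twoTorsionRamifiedAtTwo_of_odd_div_four _ ⟨-(8 * i + 13), by ring⟩

/-- `x′` is NOT odd on `W′_i` (`D = 4i+1`, `i ≥ 0`): `−7i − 19 − 6√(4i+1)` is a smaller real root of the
`2`-division cubic `(4X + 16i + 25)((X + 7i + 19)² − 36(4i+1))`. [cite: GreenbergLNM1716, §5 Remark (chunk p0174)] -/
theorem not_twoTorsionOdd_partnerAOne (i : ℤ) (hi : 0 ≤ i) :
    ¬ TwoTorsionOdd
      (⟨1, ((18 * i + 44 : ℤ) : ℚ), ((3 * i + 7 : ℤ) : ℚ), ((105 * i ^ 2 + 360 * i + 559 : ℤ) : ℚ),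
        ((196 * i ^ 3 + 792 * i ^ 2 + 2052 * i + 2019 : ℤ) : ℚ)⟩ : WeierstrassCurve ℚ)
      (((-(16 * i + 25) : ℤ) : ℚ) / 4) := by
  intro h
  set s : ℝ := Real.sqrt (4 * i + 1) with hs
  have hi' : (0 : ℝ) ≤ i := by exact_mod_cast hi
  have hs0 : 0 ≤ s := Real.sqrt_nonneg _
  have hs2 : s ^ 2 = 4 * i + 1 := by rw [hs, Real.sq_sqrt (by linarith)]
  have hroot := h (-7 * i - 19 - 6 * s) (by
    simp only [WeierstrassCurve.b₂, WeierstrassCurve.b₄, WeierstrassCurve.b₆]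
    push_cast
    linear_combination (36 * (4 * (-7 * (i : ℝ) - 19 - 6 * s) + 16 * i + 25)) * hs2)
  push_cast at hroot
  linarith

/-! ### The partner `W′_i`, branch `D = 4i + 3` -/

/-- `x′ = −(16i+25)/4` is a rational `2`-torsion abscissa of `W′_i`. [folklore] -/
theorem hasRationalTwoTorsionX_partnerAThree (i : ℤ) :
    HasRationalTwoTorsionX
      (⟨1, ((30 * i + 40 : ℤ) : ℚ), ((3 * i + 7 : ℤ) : ℚ), ((273 * i ^ 2 + 595 * i + 390 : ℤ) : ℚ),
        ((676 * i ^ 3 + 2246 * i ^ 2 + 2576 * i + 1119 : ℤ) : ℚ)⟩ : WeierstrassCurve ℚ)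
      (((-(16 * i + 25) : ℤ) : ℚ) / 4) := by
  refine hasRationalTwoTorsionX_of_twoDivision_root ?_
  simp only [WeierstrassCurve.b₂, WeierstrassCurve.b₄, WeierstrassCurve.b₆]
  push_cast
  ring

/-- Uniqueness when `4i+3` is not a square: another abscissa `z` satisfies `(z + 13i + 17)² = 36(4i+3)`. [folklore] -/
theorem hasUniqueRationalTwoTorsionX_partnerAThree (i : ℤ) (hns : ¬ IsSquare ((4 * i + 3 : ℤ) : ℚ)) :
    HasUniqueRationalTwoTorsionX
      (⟨1, ((30 * i + 40 : ℤ) : ℚ), ((3 * i + 7 : ℤ) : ℚ), ((273 * i ^ 2 + 595 * i + 390 : ℤ) : ℚ),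
        ((676 * i ^ 3 + 2246 * i ^ 2 + 2576 * i + 1119 : ℤ) : ℚ)⟩ : WeierstrassCurve ℚ)
      (((-(16 * i + 25) : ℤ) : ℚ) / 4) := by
  refine ⟨hasRationalTwoTorsionX_partnerAThree i, fun z hz ↦ ?_⟩
  obtain ⟨y, hy, h2⟩ := hz
  have hc := fourXCubed_add_eq_zero_of_twoTorsion hy h2
  simp only [WeierstrassCurve.b₂, WeierstrassCurve.b₄, WeierstrassCurve.b₆] at hc
  push_cast at hc ⊢
  have hq : (4 * z + 16 * i + 25) * ((z + 13 * i + 17) ^ 2 - 36 * (4 * i + 3)) = 0 := by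
    linear_combination hc
  rcases mul_eq_zero.mp hq with h | h
  · linarith
  · exact absurd ⟨(z + 13 * i + 17) / 6, by push_cast; linear_combination (-(1 : ℚ) / 36) * h⟩ hns

/-- `x′` is NOT odd on `W′_i` (`D = 4i+3`, `i ≥ 0`): `−13i − 17 − 6√(4i+3)` is a smaller real root.
[cite: GreenbergLNM1716, §5 Remark (chunk p0174)] -/
theorem not_twoTorsionOdd_partnerAThree (i : ℤ) (hi : 0 ≤ i) :
    ¬ TwoTorsionOdd
      (⟨1, ((30 * i + 40 : ℤ) : ℚ), ((3 * i + 7 : ℤ) : ℚ), ((273 * i ^ 2 + 595 * i + 390 : ℤ) : ℚ),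
        ((676 * i ^ 3 + 2246 * i ^ 2 + 2576 * i + 1119 : ℤ) : ℚ)⟩ : WeierstrassCurve ℚ)
      (((-(16 * i + 25) : ℤ) : ℚ) / 4) := by
  intro h
  set s : ℝ := Real.sqrt (4 * i + 3) with hs
  have hi' : (0 : ℝ) ≤ i := by exact_mod_cast hi
  have hs0 : 0 ≤ s := Real.sqrt_nonneg _
  have hs2 : s ^ 2 = 4 * i + 3 := by rw [hs, Real.sq_sqrt (by linarith)]
  have hroot := h (-13 * i - 17 - 6 * s) (by
    simp only [WeierstrassCurve.b₂, WeierstrassCurve.b₄, WeierstrassCurve.b₆]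
    push_cast
    linear_combination (36 * (4 * (-13 * (i : ℝ) - 17 - 6 * s) + 16 * i + 25)) * hs2)
  push_cast at hroot
  linarith

/-! ### The neighbour `W″_i`: full rational `2`-torsion and the Prop-5.14 point -/

/-- `0`, `12`, `(12i+3)/4` are rational `2`-torsion abscissae of `W″_i` (`D = 4i+1`). [folklore] -/
theorem hasRationalTwoTorsionX_neighbourAOne (i : ℤ) :
    HasRationalTwoTorsionX
        (⟨1, ((-3 * i - 13 : ℤ) : ℚ), ((0 : ℤ) : ℚ), ((36 * i + 9 : ℤ) : ℚ), ((0 : ℤ) : ℚ)⟩ : WeierstrassCurve ℚ) 0 ∧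
      HasRationalTwoTorsionX
        (⟨1, ((-3 * i - 13 : ℤ) : ℚ), ((0 : ℤ) : ℚ), ((36 * i + 9 : ℤ) : ℚ), ((0 : ℤ) : ℚ)⟩ : WeierstrassCurve ℚ) 12 ∧
      HasRationalTwoTorsionX
        (⟨1, ((-3 * i - 13 : ℤ) : ℚ), ((0 : ℤ) : ℚ), ((36 * i + 9 : ℤ) : ℚ), ((0 : ℤ) : ℚ)⟩ : WeierstrassCurve ℚ)
        (((12 * i + 3 : ℤ) : ℚ) / 4) := by
  refine ⟨hasRationalTwoTorsionX_of_twoDivision_root ?_, hasRationalTwoTorsionX_of_twoDivision_root ?_,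
    hasRationalTwoTorsionX_of_twoDivision_root ?_⟩ <;>
  simp only [WeierstrassCurve.b₂, WeierstrassCurve.b₄, WeierstrassCurve.b₆] <;> push_cast <;> ring

/-- `0`, `4`, `(36i+27)/4` are rational `2`-torsion abscissae of `W″_i` (`D = 4i+3`). [folklore] -/
theorem hasRationalTwoTorsionX_neighbourAThree (i : ℤ) :
    HasRationalTwoTorsionX
        (⟨1, ((-9 * i - 11 : ℤ) : ℚ), ((0 : ℤ) : ℚ), ((36 * i + 27 : ℤ) : ℚ), ((0 : ℤ) : ℚ)⟩ : WeierstrassCurve ℚ) 0 ∧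
      HasRationalTwoTorsionX
        (⟨1, ((-9 * i - 11 : ℤ) : ℚ), ((0 : ℤ) : ℚ), ((36 * i + 27 : ℤ) : ℚ), ((0 : ℤ) : ℚ)⟩ : WeierstrassCurve ℚ) 4 ∧
      HasRationalTwoTorsionX
        (⟨1, ((-9 * i - 11 : ℤ) : ℚ), ((0 : ℤ) : ℚ), ((36 * i + 27 : ℤ) : ℚ), ((0 : ℤ) : ℚ)⟩ : WeierstrassCurve ℚ)
        (((36 * i + 27 : ℤ) : ℚ) / 4) := by
  refine ⟨hasRationalTwoTorsionX_of_twoDivision_root ?_, hasRationalTwoTorsionX_of_twoDivision_root ?_,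
    hasRationalTwoTorsionX_of_twoDivision_root ?_⟩ <;>
  simp only [WeierstrassCurve.b₂, WeierstrassCurve.b₄, WeierstrassCurve.b₆] <;> push_cast <;> ring

/-- **The «`W″` block» for the branch `D = 4i+1` (`i ≥ 0`)**: `W″_i` is elliptic, globally minimal, isogenous to `W′_i`,
good ordinary at `2`, has the Prop-5.14 point `((12i+3)/4, ·)` (ramified, not odd) and three distinct rational `2`-torsion
abscissae. [folklore] -/
theorem neighbourAOne_block (i : ℤ) (hi : 0 ≤ i) :
    ∃ (W'' : WeierstrassCurve ℚ) (_ : W''.IsElliptic) (_ : W''.IsGloballyMinimal),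
      WeierstrassCurve.IsIsogenous W''
          (⟨1, ((18 * i + 44 : ℤ) : ℚ), ((3 * i + 7 : ℤ) : ℚ), ((105 * i ^ 2 + 360 * i + 559 : ℤ) : ℚ),
            ((196 * i ^ 3 + 792 * i ^ 2 + 2052 * i + 2019 : ℤ) : ℚ)⟩ : WeierstrassCurve ℚ) ∧
        IsOrdinaryAt W'' 2 ∧
        (∃ x₀ y₀ : ℚ, W''.toAffine.Equation x₀ y₀ ∧ 2 * y₀ + W''.a₁ * x₀ + W''.a₃ = 0 ∧
          ((TwoTorsionRamifiedAtTwo x₀ ∧ ¬ TwoTorsionOdd W'' x₀) ∨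
            (TwoTorsionOdd W'' x₀ ∧ ¬ TwoTorsionRamifiedAtTwo x₀))) ∧
        (∃ x₁ x₂ x₃ : ℚ, x₁ ≠ x₂ ∧ x₁ ≠ x₃ ∧ x₂ ≠ x₃ ∧ HasRationalTwoTorsionX W'' x₁ ∧
          HasRationalTwoTorsionX W'' x₂ ∧ HasRationalTwoTorsionX W'' x₃) := by
  obtain ⟨h0, h12, hq⟩ := hasRationalTwoTorsionX_neighbourAOne i
  obtain ⟨y₀, hy₀, h2y₀⟩ := hq
  have hodd3 : Odd (12 * i + 3 : ℤ) := ⟨6 * i + 1, by ring⟩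
  have hnotodd : ¬ TwoTorsionOdd
      (⟨1, ((-3 * i - 13 : ℤ) : ℚ), ((0 : ℤ) : ℚ), ((36 * i + 9 : ℤ) : ℚ), ((0 : ℤ) : ℚ)⟩ : WeierstrassCurve ℚ)
      (((12 * i + 3 : ℤ) : ℚ) / 4) := by
    intro h
    have h0r := h 0 (by simp [WeierstrassCurve.b₆])
    push_cast at h0r
    have hi' : (0 : ℝ) ≤ i := by exact_mod_cast hi
    linarith
  refine ⟨_, isElliptic_neighbourAOne i, isGloballyMinimal_neighbourAOne i, isIsogenous_neighbourAOne_partnerAOne i,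
    isOrdinaryAt_two_neighbourAOne i,
    ⟨_, y₀, hy₀, h2y₀, Or.inl ⟨Rank1Residual.X5.Instances.twoTorsionRamifiedAtTwo_of_odd_div_four _ hodd3, hnotodd⟩⟩,
    ⟨0, 12, ((12 * i + 3 : ℤ) : ℚ) / 4, by norm_num, ?_, ?_, h0, h12, ⟨y₀, hy₀, h2y₀⟩⟩⟩
  · intro h
    have h' : ((12 * i + 3 : ℤ) : ℚ) = ((0 : ℤ) : ℚ) := by push_cast at h ⊢; linarith
    have : (12 * i + 3 : ℤ) = 0 := by exact_mod_cast h'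
    omega
  · intro h
    have h' : ((12 * i + 3 : ℤ) : ℚ) = ((48 : ℤ) : ℚ) := by push_cast at h ⊢; linarith
    have : (12 * i + 3 : ℤ) = 48 := by exact_mod_cast h'
    omega

/-- **The «`W″` block» for the branch `D = 4i+3` (`i ≥ 0`).** [folklore] -/
theorem neighbourAThree_block (i : ℤ) (hi : 0 ≤ i) :
    ∃ (W'' : WeierstrassCurve ℚ) (_ : W''.IsElliptic) (_ : W''.IsGloballyMinimal),
      WeierstrassCurve.IsIsogenous W''
          (⟨1, ((30 * i + 40 : ℤ) : ℚ), ((3 * i + 7 : ℤ) : ℚ), ((273 * i ^ 2 + 595 * i + 390 : ℤ) : ℚ),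
            ((676 * i ^ 3 + 2246 * i ^ 2 + 2576 * i + 1119 : ℤ) : ℚ)⟩ : WeierstrassCurve ℚ) ∧
        IsOrdinaryAt W'' 2 ∧
        (∃ x₀ y₀ : ℚ, W''.toAffine.Equation x₀ y₀ ∧ 2 * y₀ + W''.a₁ * x₀ + W''.a₃ = 0 ∧
          ((TwoTorsionRamifiedAtTwo x₀ ∧ ¬ TwoTorsionOdd W'' x₀) ∨
            (TwoTorsionOdd W'' x₀ ∧ ¬ TwoTorsionRamifiedAtTwo x₀))) ∧
        (∃ x₁ x₂ x₃ : ℚ, x₁ ≠ x₂ ∧ x₁ ≠ x₃ ∧ x₂ ≠ x₃ ∧ HasRationalTwoTorsionX W'' x₁ ∧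
          HasRationalTwoTorsionX W'' x₂ ∧ HasRationalTwoTorsionX W'' x₃) := by
  obtain ⟨h0, h4, hq⟩ := hasRationalTwoTorsionX_neighbourAThree i
  obtain ⟨y₀, hy₀, h2y₀⟩ := hq
  have hodd27 : Odd (36 * i + 27 : ℤ) := ⟨18 * i + 13, by ring⟩
  have hnotodd : ¬ TwoTorsionOdd
      (⟨1, ((-9 * i - 11 : ℤ) : ℚ), ((0 : ℤ) : ℚ), ((36 * i + 27 : ℤ) : ℚ), ((0 : ℤ) : ℚ)⟩ : WeierstrassCurve ℚ)
      (((36 * i + 27 : ℤ) : ℚ) / 4) := by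
    intro h
    have h0r := h 0 (by simp [WeierstrassCurve.b₆])
    push_cast at h0r
    have hi' : (0 : ℝ) ≤ i := by exact_mod_cast hi
    linarith
  refine ⟨_, isElliptic_neighbourAThree i, isGloballyMinimal_neighbourAThree i,
    isIsogenous_neighbourAThree_partnerAThree i, isOrdinaryAt_two_neighbourAThree i,
    ⟨_, y₀, hy₀, h2y₀, Or.inl ⟨Rank1Residual.X5.Instances.twoTorsionRamifiedAtTwo_of_odd_div_four _ hodd27, hnotodd⟩⟩,
    ⟨0, 4, ((36 * i + 27 : ℤ) : ℚ) / 4, by norm_num, ?_, ?_, h0, h4, ⟨y₀, hy₀, h2y₀⟩⟩⟩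
  · intro h
    have h' : ((36 * i + 27 : ℤ) : ℚ) = ((0 : ℤ) : ℚ) := by push_cast at h ⊢; linarith
    have : (36 * i + 27 : ℤ) = 0 := by exact_mod_cast h'
    omega
  · intro h
    have h' : ((36 * i + 27 : ℤ) : ℚ) = ((16 : ℤ) : ℚ) := by push_cast at h ⊢; linarith
    have : (36 * i + 27 : ℤ) = 16 := by exact_mod_cast h'
    omega

end PartnerTypeATorsion

end Summit.BirchSwinnertonDyer.Rank2

end
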